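import Mathlib
import Summits.Ventures.PercRepro2.Harris
import Summits.Ventures.PercRepro2.BasePrime
import Summits.Ventures.PercRepro2.LocRows
import Summits.Ventures.PercRepro2.SwRow
import Summits.Ventures.PercRepro2.SwOut
import Summits.Ventures.PercRepro2.SwAllRow
import Summits.Ventures.PercRepro2.SwOutAll
import Summits.Ventures.PercRepro2.SwOutCube
import Summits.Ventures.PercRepro2.SwOutArmFlip
import Summits.Ventures.PercRepro2.SwOutArms
import Summits.Ventures.PercRepro2.SwOutArmOrbit
import Summits.Ventures.PercRepro2.SwOutArmCube
import Summits.Ventures.PercRepro2.SwOutArmThm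
import Summits.Ventures.PercRepro2.SwOutCoreDefs
import Summits.Ventures.PercRepro2.SwOutCoreDual
import Summits.Ventures.PercRepro2.SwOutShadowDefs

/-!
# THE SHADOW CUBE INEQUALITY (blind cell PercRepro2, night-4 g13, 2026-08-26;
proofs/NIGHT4-G12.md §3 (L4), proofs/NIGHT4-G13.md §3)

Colour symmetry of the shadow cube (`ShadowBase.dual`, `blue_shadowReal`,
`cluster_blue_shadowReal`), the monotonicity of the clusters of `l` along the cube
(`cluster_l_shadowReal_anti`, `cluster_blue_l_shadowReal_mono` — the envelope `sAll` is
red-closed and avoids `l`), the monotonicity of the edge sets of `h` and the flip exchange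
(`redEdges_shadowReal_mono`, `blueEdges_shadowReal_anti`, `blueEdges_shadowReal_flipAll`), the
conditioning `Q` as a lower set (`shadowReal_mem_tgtU_of_le`) and the rigid counting inequality on
the shadow cube (**`card_shadowCube_le`**) by the cube principle `card_le_of_cube_edges`: the
second block of Theorem A of NIGHT4-G12.md in the kernel.
-/

namespace Summit.Ventures.PercRepro2

namespace LocRows

open Hull

variable {V : Type*} {E : Type*}

open scoped Classical

variable {ends : E → Sym2 V}

section Dual

variable {κ : Type*} {B : κ → Set V} {Z : Set V} {k₀ : κ} {σ : Config E} {h : V}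
  (hb : ShadowBase ends σ h Z B k₀)
include hb

omit hb in
/-- A selection of arms, with the decoration when `B k₀` is selected. -/
def shadowSel (B : κ → Set V) (Z : Set V) (k₀ : κ) (p : κ → Prop) : Set V :=
  {x | ∃ j, p j ∧ x ∈ B j} ∪ {x | p k₀ ∧ x ∈ Z}

omit hb in
/-- `shadowFalse` is a selection. -/
lemma shadowFalse_eq_shadowSel (ω : Config κ) :
    shadowFalse B Z k₀ ω = shadowSel B Z k₀ (fun j => ω j = false) := rfl

/-- An edge with an end in `B j` touches a selection iff `B j` is selected. -/
lemma ShadowBase.touches_shadowSel_iff_of_mem {p : κ → Prop} {j : κ} {e : E} {x y : V}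
    (hxy : ends e = s(x, y)) (hx : x ∈ B j) :
    e ∈ touches ends (shadowSel B Z k₀ p) ↔ p j := by
  constructor
  · rintro ⟨z, hz, w, hzw⟩
    rw [hxy, Sym2.eq_iff] at hzw
    rcases hz with ⟨j', hj', hzj'⟩ | ⟨hk, hzZ⟩
    · rcases hzw with ⟨h1, _⟩ | ⟨_, h2⟩
      · rw [h1] at hx
        have : j' = j := by
          by_contra hne
          exact hb.B_disj j' j hne z hzj' hx
        rw [← this]; exact hj'
      · rw [← h2] at hzj'
        have := hb.arm_eq_of_edge hxy hx hzj'
        rw [this]; exact hj'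
    · rcases hzw with ⟨h1, _⟩ | ⟨_, h2⟩
      · rw [h1] at hx
        exact absurd hzZ (hb.B_disj_Z j z hx)
      · rw [← h2] at hzZ
        have hjk : j = k₀ := by
          by_contra hne
          exact hb.no_BZ j hne e x y hxy hx hzZ
        rw [hjk]; exact hk
  · intro hj
    exact ⟨x, Or.inl ⟨j, hj, hx⟩, y, hxy⟩

/-- An edge with an end in `Z` and no end in an arm touches a selection iff `B k₀` is selected. -/
lemma ShadowBase.touches_shadowSel_iff_of_mem_Z {p : κ → Prop} {e : E} {x y : V}
    (hxy : ends e = s(x, y)) (hx : x ∈ Z) (hyB : ∀ j, y ∉ B j) :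
    e ∈ touches ends (shadowSel B Z k₀ p) ↔ p k₀ := by
  constructor
  · rintro ⟨z, hz, w, hzw⟩
    rw [hxy, Sym2.eq_iff] at hzw
    rcases hz with ⟨j, _, hzj⟩ | ⟨hk, _⟩
    · exfalso
      rcases hzw with ⟨h1, _⟩ | ⟨_, h2⟩
      · rw [h1] at hx; exact hb.B_disj_Z j z hzj hx
      · rw [← h2] at hzj; exact hyB j hzj
    · exact hk
  · intro hk
    exact ⟨x, Or.inr ⟨hk, hx⟩, y, hxy⟩

omit hb in
/-- The ends of an edge touching the arms or the decoration. -/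
lemma ShadowBase.exists_coord {e : E} (he : e ∈ touches ends (shadowAll B Z)) :
    (∃ j x y, ends e = s(x, y) ∧ x ∈ B j) ∨
      (∃ x y, ends e = s(x, y) ∧ x ∈ Z ∧ ∀ j, y ∉ B j) := by
  obtain ⟨x, hx, y, hxy⟩ := he
  rcases hx with ⟨j, hxj⟩ | hxZ
  · exact Or.inl ⟨j, x, y, hxy, hxj⟩
  · by_cases hyB : ∃ j, y ∈ B j
    · obtain ⟨j, hyj⟩ := hyB
      exact Or.inl ⟨j, y, x, ends_swap hxy, hyj⟩
    · exact Or.inr ⟨x, y, hxy, hxZ, fun j hj => hyB ⟨j, hj⟩⟩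

omit hb in
/-- A selection lies in the arms and the decoration. -/
lemma shadowSel_subset_shadowAll (p : κ → Prop) : shadowSel B Z k₀ p ⊆ shadowAll B Z := by
  rintro x (⟨j, _, hx⟩ | ⟨_, hx⟩)
  · exact Or.inl ⟨j, hx⟩
  · exact Or.inr hx

/-- **Going down the shadow cube flips red arms (with the decoration) to blue.** -/
theorem ShadowBase.shadowReal_eq_flip_of_le {ω ω' : Config κ} (hω : ω ≤ ω') :
    shadowReal ends B Z k₀ σ ω =
      flip ends (shadowSel B Z k₀ (fun j => ω j = false ∧ ω' j = true))
        (shadowReal ends B Z k₀ σ ω') := by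
  funext e
  by_cases he : e ∈ touches ends (shadowAll B Z)
  · have key : ∀ j, shadowReal ends B Z k₀ σ ω e =
        (if ω j = true then σ e else !σ e) →
        shadowReal ends B Z k₀ σ ω' e = (if ω' j = true then σ e else !σ e) →
        (e ∈ touches ends (shadowSel B Z k₀ (fun j => ω j = false ∧ ω' j = true)) ↔
          (ω j = false ∧ ω' j = true)) →
        shadowReal ends B Z k₀ σ ω e =
          flip ends (shadowSel B Z k₀ (fun j => ω j = false ∧ ω' j = true))
            (shadowReal ends B Z k₀ σ ω') e := by
      intro j h1 h2 hD
      rw [h1]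
      by_cases hD' : ω j = false ∧ ω' j = true
      · rw [flip_apply_of_mem (hD.2 hD'), h2, if_pos hD'.2, if_neg (by rw [hD'.1]; decide)]
      · rw [flip_apply_of_notMem (fun h' => hD' (hD.1 h')), h2]
        have := hω j
        cases h3 : ω j
        · cases h4 : ω' j
          · simp
          · exact absurd ⟨h3, h4⟩ hD'
        · cases h4 : ω' j
          · rw [h3, h4] at this; exact absurd this (by simp)
          · simp
    rcases ShadowBase.exists_coord he with ⟨j, x, y, hxy, hx⟩ | ⟨x, y, hxy, hx, hyB⟩
    · exact key j (hb.shadowReal_apply_of_mem hxy hx) (hb.shadowReal_apply_of_mem hxy hx)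
        (hb.touches_shadowSel_iff_of_mem hxy hx)
    · exact key k₀ (hb.shadowReal_apply_of_mem_Z hxy hx hyB)
        (hb.shadowReal_apply_of_mem_Z hxy hx hyB) (hb.touches_shadowSel_iff_of_mem_Z hxy hx hyB)
  · rw [ShadowBase.shadowReal_apply_of_notMem he, flip_apply_of_notMem,
      ShadowBase.shadowReal_apply_of_notMem he]
    exact fun h' => he (touches_mono (shadowSel_subset_shadowAll _) h')

omit hb in
/-- `sAll ω` lies in `{h} ∪ arms ∪ Z`. -/
lemma sAll_subset (ω : Config κ) :
    sAll B Z k₀ h ω ⊆ {h} ∪ {x | ∃ j, x ∈ B j} ∪ Z := by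
  intro x hx
  rw [mem_sAll_iff] at hx
  rcases hx with rfl | ⟨j, _, hx⟩ | ⟨_, hx⟩
  · exact Or.inl (Or.inl rfl)
  · exact Or.inl (Or.inr ⟨j, hx⟩)
  · exact Or.inr hx

/-- **`sAll ω` is closed under red adjacency.** -/
theorem ShadowBase.sAll_closed (ω : Config κ) :
    ∀ a ∈ sAll B Z k₀ h ω, ∀ b, (openGraph ends (shadowReal ends B Z k₀ σ ω)).Adj a b →
      b ∈ sAll B Z k₀ h ω := by
  intro a ha b hab
  obtain ⟨_, e, he, hends⟩ := openGraph_adj.1 hab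
  rw [mem_sAll_iff] at ha ⊢
  rcases ha with rfl | ⟨j, hj, ha⟩ | ⟨hk, ha⟩
  · obtain ⟨j, hj, hbj⟩ := hb.red_arm_of_red_at_h hends he
    exact Or.inr (Or.inl ⟨j, hj, hbj⟩)
  · rcases hb.end_of_red_of_mem_arm hj hends ha he with hbj | hbh
    · exact Or.inr (Or.inl ⟨j, hj, hbj⟩)
    · exact Or.inl hbh
  · -- from the decoration (with `B k₀` red): the edge stays inside `Z`
    by_cases hbB : ∃ j, b ∈ B j
    · exfalso
      obtain ⟨j, hbj⟩ := hbB
      have hjk : j = k₀ := by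
        by_contra hne
        exact hb.no_BZ j hne e b a (ends_swap hends) hbj ha
      subst hjk
      rw [hb.shadowReal_apply_of_mem (ends_swap hends) hbj, if_pos hk,
        hb.kZ_blue e b a (ends_swap hends) hbj ha] at he
      exact absurd he (by decide)
    by_cases hbZ : b ∈ Z
    · exact Or.inr (Or.inr ⟨hk, hbZ⟩)
    exfalso
    have hbh : b ≠ h := fun hbh => hb.no_hZ e a (by rw [hbh] at hends; exact ends_swap hends) ha
    have hyB : ∀ j, b ∉ B j := fun j hj => hbB ⟨j, hj⟩
    rw [hb.shadowReal_apply_of_mem_Z hends ha hyB, if_pos hk,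
      hb.bdry_blue e a b hends (Or.inr ha) (by
        rintro ((h' | h') | h')
        · exact hbh h'
        · exact hbB h'
        · exact hbZ h')] at he
    exact absurd he (by decide)

/-- **The red cluster of `l` grows going down the shadow cube** (`l` outside the arms, `Z`, `h`). -/
theorem ShadowBase.cluster_l_shadowReal_anti {l : V}
    (hl : l ∉ {h} ∪ {x | ∃ j, x ∈ B j} ∪ Z) {ω ω' : Config κ} (hω : ω ≤ ω') :
    cluster ends (shadowReal ends B Z k₀ σ ω') l ⊆ cluster ends (shadowReal ends B Z k₀ σ ω) l := by
  rw [hb.shadowReal_eq_flip_of_le hω]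
  refine cluster_l_subset_flip_of_disjoint ?_ ?_
  · intro x hx hxl
    have hxR : x ∈ sAll B Z k₀ h ω' := by
      rw [mem_sAll_iff]
      rcases hx with ⟨j, ⟨_, hj'⟩, hx⟩ | ⟨⟨_, hk'⟩, hx⟩
      · exact Or.inr (Or.inl ⟨j, hj', hx⟩)
      · exact Or.inr (Or.inr ⟨hk', hx⟩)
    have hlR : l ∈ sAll B Z k₀ h ω' :=
      mem_of_conn_of_closed (hb.sAll_closed ω') hxR (conn_symm hxl)
    exact hl (sAll_subset ω' hlR)
  · intro hlD
    exact hl (sAll_subset ω' (by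
      rw [mem_sAll_iff]
      rcases hlD with ⟨j, ⟨_, hj'⟩, hx⟩ | ⟨⟨_, hk'⟩, hx⟩
      · exact Or.inr (Or.inl ⟨j, hj', hx⟩)
      · exact Or.inr (Or.inr ⟨hk', hx⟩)))

omit hb in
/-- The dual shadow base: the colour swap, then everything touching the arms or `Z` flipped back. -/
noncomputable def dualShadow (ends : E → Sym2 V) (B : κ → Set V) (Z : Set V) (σ : Config E) :
    Config E :=
  flip ends (shadowAll B Z) (blue σ)

omit hb in
/-- The dual shadow base on an edge touching the arms or `Z`. -/
lemma dualShadow_apply_of_mem {e : E} (he : e ∈ touches ends (shadowAll B Z)) :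
    dualShadow ends B Z σ e = σ e := by
  simp only [dualShadow, flip_apply_of_mem he, blue_apply, Bool.not_not]

omit hb in
/-- The dual shadow base on an edge touching neither. -/
lemma dualShadow_apply_of_notMem {e : E} (he : e ∉ touches ends (shadowAll B Z)) :
    dualShadow ends B Z σ e = !σ e := by
  simp only [dualShadow, flip_apply_of_notMem he, blue_apply]

/-- An edge inside `B j ∪ {h}` touches an arm. -/
lemma ShadowBase.touches_shadowAll_of_within {j : κ} {e : E} (he : e ∈ within ends (B j ∪ {h})) :
    e ∈ touches ends (shadowAll B Z) := by
  obtain ⟨x, hx, y, hy, hxy⟩ := he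
  rcases hx with hx | hx
  · exact ⟨x, Or.inl ⟨j, hx⟩, y, hxy⟩
  · rcases hy with hy | hy
    · exact ⟨y, Or.inl ⟨j, hy⟩, x, ends_swap hxy⟩
    · exfalso
      rw [Set.mem_singleton_iff] at hx hy
      subst hx; subst hy
      exact hb.loop_h e hxy

/-- The inside colourings of the arms are the same for the dual shadow base. -/
lemma ShadowBase.insideConfig_dualShadow (j : κ) :
    insideConfig ends (B j ∪ {h}) (dualShadow ends B Z σ) = insideConfig ends (B j ∪ {h}) σ := by
  funext e
  simp only [insideConfig]
  by_cases he : e ∈ within ends (B j ∪ {h})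
  · rw [dualShadow_apply_of_mem (hb.touches_shadowAll_of_within he)]
  · rw [decide_eq_false he]
    simp

/-- **The dual shadow base is a shadow base** with the same arms and decoration. -/
theorem ShadowBase.dual : ShadowBase ends (dualShadow ends B Z σ) h Z B k₀ where
  h_notMem_B := hb.h_notMem_B
  h_notMem_Z := hb.h_notMem_Z
  B_disj := hb.B_disj
  B_disj_Z := hb.B_disj_Z
  B_nonempty := hb.B_nonempty
  bdry_blue := by
    intro e x y hxy hxR hyR
    by_cases he : e ∈ touches ends (shadowAll B Z)
    · rw [dualShadow_apply_of_mem he]; exact hb.bdry_blue e x y hxy hxR hyR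
    · exfalso
      rcases hxR with (hxh | ⟨j, hxj⟩) | hxZ
      · rw [Set.mem_singleton_iff] at hxh
        subst hxh
        obtain ⟨j, hyj⟩ := hb.h_edges e y hxy
        exact hyR (Or.inl (Or.inr ⟨j, hyj⟩))
      · exact he ⟨x, Or.inl ⟨j, hxj⟩, y, hxy⟩
      · exact he ⟨x, Or.inr hxZ, y, hxy⟩
  no_cross := hb.no_cross
  no_BZ := hb.no_BZ
  no_hZ := hb.no_hZ
  kZ_blue := by
    intro e x y hxy hx hy
    rw [dualShadow_apply_of_mem ⟨x, Or.inl ⟨k₀, hx⟩, y, hxy⟩]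
    exact hb.kZ_blue e x y hxy hx hy
  h_edges := hb.h_edges
  h_red := by
    intro e x hxe
    obtain ⟨j, hxj⟩ := hb.h_edges e x hxe
    rw [dualShadow_apply_of_mem ⟨x, Or.inl ⟨j, hxj⟩, h, ends_swap hxe⟩]
    exact hb.h_red e x hxe
  B_conn := by
    intro j x hx
    rw [hb.insideConfig_dualShadow j]
    exact hb.B_conn j x hx

/-- **The blue colouring of a shadow point is the dual realisation of the flipped point.** -/
theorem ShadowBase.blue_shadowReal (ω : Config κ) :
    blue (shadowReal ends B Z k₀ σ ω) = shadowReal ends B Z k₀ (dualShadow ends B Z σ) (flipAll ω) := by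
  funext e
  by_cases he : e ∈ touches ends (shadowAll B Z)
  · rcases ShadowBase.exists_coord he with ⟨j, x, y, hxy, hx⟩ | ⟨x, y, hxy, hx, hyB⟩
    · rw [blue_apply, hb.shadowReal_apply_of_mem hxy hx, hb.dual.shadowReal_apply_of_mem hxy hx,
        dualShadow_apply_of_mem he]
      cases hωj : ω j <;> simp [flipAll, hωj]
    · rw [blue_apply, hb.shadowReal_apply_of_mem_Z hxy hx hyB,
        hb.dual.shadowReal_apply_of_mem_Z hxy hx hyB, dualShadow_apply_of_mem he]
      cases hωk : ω k₀ <;> simp [flipAll, hωk]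
  · rw [blue_apply, ShadowBase.shadowReal_apply_of_notMem he,
      ShadowBase.shadowReal_apply_of_notMem he, dualShadow_apply_of_notMem he]

/-- **The blue cluster of `h` of a shadow point**: `sRed` of the flipped point. -/
theorem ShadowBase.cluster_blue_shadowReal (ω : Config κ) :
    cluster ends (blue (shadowReal ends B Z k₀ σ ω)) h = sRed B h (flipAll ω) := by
  rw [hb.blue_shadowReal]
  exact hb.dual.cluster_shadowReal (flipAll ω)

/-- **The blue cluster of `l` shrinks going down the shadow cube.** -/
theorem ShadowBase.cluster_blue_l_shadowReal_mono {l : V}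
    (hl : l ∉ {h} ∪ {x | ∃ j, x ∈ B j} ∪ Z) {ω ω' : Config κ} (hω : ω ≤ ω') :
    cluster ends (blue (shadowReal ends B Z k₀ σ ω)) l ⊆
      cluster ends (blue (shadowReal ends B Z k₀ σ ω')) l := by
  rw [hb.blue_shadowReal, hb.blue_shadowReal]
  exact hb.dual.cluster_l_shadowReal_anti hl (flipAll_le_flipAll hω)

/-- The hull of `h` of every shadow point lies in `{h} ∪ arms`. -/
theorem ShadowBase.hull_shadowReal_subset (ω : Config κ) :
    hull ends (shadowReal ends B Z k₀ σ ω) h ⊆ {h} ∪ {x | ∃ j, x ∈ B j} := by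
  intro x hx
  have key : ∀ ω', sRed B h ω' ⊆ {h} ∪ {x | ∃ j, x ∈ B j} := by
    intro ω' y hy
    rw [mem_sRed_iff] at hy
    rcases hy with rfl | ⟨j, _, hy⟩
    · exact Or.inl rfl
    · exact Or.inr ⟨j, hy⟩
  rcases hx with hx | hx
  · rw [hb.cluster_shadowReal] at hx; exact key ω hx
  · rw [hb.cluster_blue_shadowReal] at hx; exact key (flipAll ω) hx

end Dual

end LocRows

end Summit.Ventures.PercRepro2
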